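import Summits.CriticalPhenomena.SAWScalingLimit.Theorems.ObservableToSLE.Negative.Identification
import Summits.CriticalPhenomena.SAWScalingLimit.Theorems.ObservableToSLE.Negative.DeepEndpoints
import Summits.CriticalPhenomena.SAWScalingLimit.Theorems.SAWDefectDecoherenceObservableToSLERNestedGateDefs
import Summits.CriticalPhenomena.SAWScalingLimit.Theorems.SAWDefectDecoherenceObservableToSLERNestedLinkDefs
import HarnessLib

/-!
# The abundance input with UNBOUNDED locality scale is unsatisfiable (line `six-class-type-ladder`,
crux `SAWDevelopingMap.ObservableToSLE`, stmt-CriticalPhenomena-10472; equally the twin crux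
stmt-CriticalPhenomena-14005, line `bridge-gate-renewal`)

Landing target:
`Summits/CriticalPhenomena/SAWScalingLimit/Theorems/SAWDevelopingMapObservableToSLETypeLadderNotNestedRenewal.lean`
(`--supports stmt-CriticalPhenomena-10472`; continuation lead prover-line-stmt-CriticalPhenomena-10472-c3-0).

Audit-by-Lean of the registered abundance stubs `stub_nestedRenewalFatCo` (this crux, skeleton r2) and
`stub_nestedRenewalFat` (twin, r7), both instances of the skeletons' `NestedRenewalP P`:
"for EVERY locality scale `R > 0` there are `ρ`, `N` and, at every small mesh, tame nested families whose
first good gates are widely linked with probability `≥ 1 − ε`".  A good gate (`IsGoodGateN`) carries a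
`ρ/4`-WIDE ESCAPE (`WideEscape`): a path ending at a point `y` with `closedBall y (ρ/4) ⊆ Ω` and
`2R ≤ dist y (δ c_root)`.  In a BOUNDED domain no such point exists once `2R` exceeds the diameter, so for
large `R` no walk has a good gate, the bad event is everything, and its probability is `1 > ε`:

* `not_wideEscape_of_subset_ball` — no wide escape to distance `2R ≥ 4` inside the unit disc from a root of
  norm `< 2`;
* `stub_not_nestedRenewalP` (registered) — for EVERY family constraint `P`, `¬ NestedRenewalP P` (inlined),
  witnessed on `(𝔻; 1, −1)` with the deep-start endpoint approximation of `Negative.DeepEndpoints`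
  (`ε = 1/2`, `R = 2`).

Consequence for both lines (not a refutation of either crux): the abundance stub must be RE-TYPED with the
locality scale bounded after the domain and the accuracy — `∀ ε > 0, ∃ R₂ > 0, ∀ R ∈ Set.Ioc 0 R₂, ∃ ρ > 0,
∃ N, …` — which is all the landed nested transfer ever uses (it applies abundance at
`R := min (min R₀ R₁) (η / (2 (3K + 1)))`, `…NestedTransferP.lean`); the transfer is re-proved for the
re-typed input in the lead's skeleton r3 (stub `stub_nestedTransferPR`).
-/

noncomputable section

open scoped BigOperators Topology NNReal ENNReal Classical
open Filter Set MeasureTheory Metric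
open Literature.Probability.LatticeModels (HexVertex hexGraph hexCenter)
open Literature.Probability.RandomPlanarGeometry
open Literature.Probability.RandomPlanarGeometry.SAW

namespace Summit.CriticalPhenomena.SAWScalingLimit.Theorems.ObservableToSLE.TypeLadder

open Summit.CriticalPhenomena.SAWScalingLimit.Theorems.ObservableToSLER.BridgeGate
open Summit.CriticalPhenomena.SAWScalingLimit.Theorems.ObservableToSLER.NestedGate

/-- **No wide escape far away in a small domain.**  If `Ω` lies in the unit disc, the rescaled root has
norm `< 2` and `2 ≤ R`, then no `ρ/4`-wide escape (`ρ ≥ 0`) from any gate vertex reaches distance `2R`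
from the root: its endpoint `y` would satisfy `closedBall y (ρ/4) ⊆ Ω`, hence `‖y‖ < 1`, hence
`dist y (δ c_root) < 3 < 2R`. [folklore] -/
theorem not_wideEscape_of_subset_ball {Ω : Set ℂ} {δ ρ R : ℝ} {S : Set HexVertex} {c q : HexVertex}
    (hΩ : Ω ⊆ ball (0 : ℂ) 1) (hρ : 0 ≤ ρ) (hc : ‖(δ : ℂ) * hexCenter c‖ < 2) (hR : 2 ≤ R) :
    ¬ WideEscape Ω δ ρ R S c q := by
  rintro ⟨x, y, γ, -, hy, hγ⟩
  have hyΩ : y ∈ Ω := by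
    have h1 : y ∈ closedBall (γ 1) (ρ / 4) := by
      rw [γ.target]
      exact mem_closedBall_self (by positivity)
    exact (hγ 1).1 h1
  have hy1 : ‖y‖ < 1 := by simpa using hΩ hyΩ
  have hdist : dist y ((δ : ℂ) * hexCenter c) < 3 := by
    calc dist y ((δ : ℂ) * hexCenter c) = ‖y - (δ : ℂ) * hexCenter c‖ := dist_eq_norm _ _
      _ ≤ ‖y‖ + ‖(δ : ℂ) * hexCenter c‖ := norm_sub_le _ _
      _ < 1 + 2 := add_lt_add hy1 hc
      _ = 3 := by norm_num
  linarith

/-- **The abundance input with unbounded locality scale is FALSE for every family constraint `P`**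
(registered sub-goal `stub_not_nestedRenewalP`; the statement negated is the skeletons'
`NestedRenewalP P` verbatim, so this refutes `stub_nestedRenewalFatCo` of this line and
`stub_nestedRenewalFat` of the twin line AS TYPED — `∀ R > 0` must become `∃ R₂ > 0, ∀ R ∈ Ioc 0 R₂`).
Witness: the unit disc `(𝔻; 1, −1)` with the deep-start endpoint approximation
(`Negative.exists_isEmbEndpointApprox_deep`), `ε = 1/2`, `R = 2`: eventually the critical SAW law is a
probability measure (`Negative.eventually_isProbabilityMeasure_hexSAWLaw`) and the rescaled source has
norm `< 2`, while a first good gate would carry a wide escape to distance `4` inside `𝔻`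
(`not_wideEscape_of_subset_ball`); so the bad event is the whole space and has mass `1 > 1/2`. [folklore] -/
theorem stub_not_nestedRenewalP :
    ∀ (P : DobrushinDomain → (ℝ → HexVertex) → (ℝ → HexVertex) → ℝ → ℝ → ℝ → ℕ →
      (ℕ → Set HexVertex) → (ℕ → Set HexVertex) → Prop),
    ¬ (∀ (D : DobrushinDomain) (a b : ℝ → HexVertex), IsEmbEndpointApprox hexGraph hexCenter D a b →
        ∀ ε > (0 : ℝ), ∀ R > (0 : ℝ), ∃ ρ > (0 : ℝ), ∃ N : ℕ, ∀ᶠ δ : ℝ in 𝓝[>] 0,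
          ∃ S T : ℕ → Set HexVertex,
            TameNestedFamily δ R N (a δ) S ∧ TameNestedFamily δ R N (b δ) T ∧
            P D a b δ ρ R N S T ∧
            hexSAWLaw D.carrier δ (a δ) (b δ)
                {γ | ¬ ∃ (n m : ℕ) (p q : HexVertex) (n' m' : ℕ) (p' q' : HexVertex),
                    IsFirstGoodGateN D.carrier δ ρ R S (a δ) γ.walk.support n m p q ∧
                    IsFirstGoodGateN D.carrier δ ρ R T (b δ) γ.walk.support.reverse n' m' p' q' ∧
                    WideLink D.carrier δ ρ (S n ∪ T n') q q'} ≤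
              ENNReal.ofReal ε) := by
  intro P h
  obtain ⟨a, b, hab, -⟩ :=
    Summit.CriticalPhenomena.SAWScalingLimit.Theorems.ObservableToSLE.Negative.exists_isEmbEndpointApprox_deep
  obtain ⟨ρ, hρ, N, hev⟩ :=
    h DobrushinDomain.unitDisc a b hab (1 / 2) (by norm_num) 2 (by norm_num)
  have hnorm : ∀ᶠ δ : ℝ in 𝓝[>] 0, ‖(δ : ℂ) * hexCenter (a δ)‖ < 2 := by
    have h1 : ‖DobrushinDomain.unitDisc.pt 0‖ < 2 := by
      rw [Literature.Probability.Percolation.unitDisc_pt_zero]; simp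
    exact hab.tendsto_fst.norm (Iio_mem_nhds h1)
  obtain ⟨δ, ⟨S, T, -, -, -, hbad⟩, hprob, hδn⟩ :=
    (hev.and ((Summit.CriticalPhenomena.SAWScalingLimit.Theorems.ObservableToSLE.Negative.eventually_isProbabilityMeasure_hexSAWLaw
      hab).and hnorm)).exists
  have huniv : {γ : HexDomainSAW DobrushinDomain.unitDisc.carrier δ (a δ) (b δ) |
      ¬ ∃ (n m : ℕ) (p q : HexVertex) (n' m' : ℕ) (p' q' : HexVertex),
        IsFirstGoodGateN DobrushinDomain.unitDisc.carrier δ ρ 2 S (a δ) γ.walk.support n m p q ∧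
        IsFirstGoodGateN DobrushinDomain.unitDisc.carrier δ ρ 2 T (b δ) γ.walk.support.reverse
          n' m' p' q' ∧
        WideLink DobrushinDomain.unitDisc.carrier δ ρ (S n ∪ T n') q q'} = univ := by
    refine eq_univ_of_forall fun γ => ?_
    rintro ⟨n, m, p, q, -, -, -, -, hg, -, -⟩
    exact not_wideEscape_of_subset_ball (Ω := DobrushinDomain.unitDisc.carrier)
      (by rw [Literature.Probability.Percolation.unitDisc_carrier]) hρ.le hδn le_rfl hg.1.2.2.2
  rw [huniv, measure_univ] at hbad
  have hlt : ENNReal.ofReal (1 / 2 : ℝ) < 1 := by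
    rw [ENNReal.ofReal_lt_one]; norm_num
  exact absurd hbad (not_le.mpr hlt)

end Summit.CriticalPhenomena.SAWScalingLimit.Theorems.ObservableToSLE.TypeLadder

end
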